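/-
Copyright (c) 2026 the pub-hodgecm-mathlib formalisation cell (harness21).  Prover seat hodgecm-mathlib-K2Liu-p14 (g3), Track B «K2-LIT»,
#184♮ = hLiu418 = `stmt-HodgeConjecture-24832`; Road I v3, S5-F3 lineage ∕ I4-conv (F′-fact), E-3a: the `T′`-tensor of the term-2 integrand in natural coordinates.
-/
import Summits.HodgeConjecture.HodgeConjecture.Theorems.K2LiuKlingenInnerSectionShapeArch     -- ★ E-1b (+ ★ E-1 `integrand_eq_mul_finprod`, arch letters; ★ B letters, `psiLoc`; ★ B2)
import Summits.HodgeConjecture.HodgeConjecture.Theorems.K2LiuKlingenFibreLocalCoordinates    -- ★ bridge (F0P2-p09): `exists_localCoord` (L2: quadratic `T′`-coordinates ↦ `(y_v, t_v)`)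
import HarnessLib

/-!
# Crux `HLiu418`, I4-conv (F′-fact), E-3a — `K2LiuKlingenTermTwoTensor`: THE `T′`-TENSOR OF THE TERM-2 INTEGRAND IN THE NATURAL COORDINATES OF ★ E-D0

Cell `hodgecm-mathlib`, crux item hLiu418 = `stmt-HodgeConjecture-24832`; squad K2 ∕ K2Liu; LEAD F0P6-plan (g14) BATCH #36 (E = K2Liu-p14 (g3)).  THEOREMS ONLY (no `def`,
no instance, no notation, no named-fact hypothesis, no `sorry`); lane `--supports stmt-HodgeConjecture-24832 --as helper` (count-neutral).

THE POINT.  ★ E-D0 `K2LiuKlingenFibreEulerNatural.exists_natural_integral_eq_mul_tprod` factorises `∫ F d(μ_Y ⊗ μ_T)` for integrands of NATURAL shape `F q =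
gN (((↑q.1).1, q.2.1), T′-quadratic coords of q) · ∏ᶠ_{v∉T′} φN v (q.1_v, q.2_v)`, `gN` a function on the key space `X_{T′} = (L_∞ × L_∞) × Π_{v∈T′} (L⁺_v)³`; ★ #31s
`IsFactorizableOff` writes the term-2 integrand `f_s(Ψ(ξ)Ψ(n_Q(y,0,t))(Ψ(m_Q(1,j₂⁻¹g₂))h))` as `fT_s(archPart, T′-letters) · ∏ᶠ_{v∉T′} Λ_{s,v}(…)`, a function of `q`.  HERE:
§1 `adeleToLocal_eq_of_quadCoords_eq` (the `T′`-quadratic coordinates DETERMINE `(y_v, t_v)`: ★ bridge `exists_localCoord` L2), the place-`v` letters in ★ B's currency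
(`evalPlace_finPart_letters_zero`, `evalPlace_finPart_arg_congr{,_levi}`); §2 `tensor_factorsThrough` (the `T′`-part FACTORS THROUGH the key `π q = ((y_∞, t_∞),
T′-quadratic coords)`: ★ E-1 `archPart_arg_eq_of_fst_eq`, ★ B, §1), `tensor_eq_of_archPart_eq` (it depends on `g₂` only through `(archPart g₂, ((g₂)_v)_{v∈T′})`: ★ E-1b);
§3 **`exists_tensor`** (`∃ gN : ℂ → U(J₂)(𝔸) → X_{T′} → ℂ` with (i) `fT_s(archPart(arg_{g₂} q), T′-letters) = gN s g₂ (π q)`, (ii) `gN s g₂ = gN s g₂'` when `archPart g₂ =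
archPart g₂'` and `(g₂)_v = (g₂')_v` on `T′`; `Function.extend` along `π`), **`integrand_eq_tensor_mul_finprod`** = THE SHAPE `hF` OF ★ E-D0 for the term-2 integrand:
`f_s(arg_{g₂} q) = gN s g₂ (π q) · ∏ᶠ_{v∉T′} φ_v(q.1_v, q.2_v)`, `φ_v` = the integrand of ★ B `innerSectionLoc v … (psiLoc Ψ v) (Λ_{s,v}) h_v (g₂)_v`.
CURRENCY.  `Ψ : U(J₄)(𝔸) →* H(𝔸)` pinned by an adelic matrix `SA` (★ B's binder `hΨ` VERBATIM, `N = 4`); the F-files' `Ψ ≃ₜ*` enters as `Ψ.toMulEquiv.toMonoidHom`,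
`hΨ := fun g => hΨ g` (as in ★ E-1).  [CasselsFrohlichANT1967, Ch. II §10, §14], [BorelJacquet1979, §4.1], [MoeglinWaldspurger1995, II.1.7], [Liu2011, §2B p. 862].
HONEST LABEL.  Count-neutral helper, closes no socket: `HC_CM` is proved only modulo the 7 printed citations (2 remaining named inputs: hLiu418 =
`stmt-HodgeConjecture-24832`, h413 = `stmt-HodgeConjecture-24833`) until rung 0 closes.
-/

set_option autoImplicit false
set_option linter.dupNamespace false -- the mandated namespace repeats `HodgeConjecture.HodgeConjecture`

noncomputable section

open scoped Matrix
open NumberField IsDedekindDomain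

namespace Summit.HodgeConjecture.HodgeConjecture.Cruxes.HLiu418.K2LiuKlingenTermTwoTensor

open Literature.NumberTheory.Automorphic Literature.NumberTheory.Automorphic.UnitaryGroup
open Literature.NumberTheory.GelbartRogawski1991 Literature.NumberTheory.GelbartRogawski1991.GRConstruction
open Literature.NumberTheory.GaloisRepresentations
open Literature.NumberTheory.K2Lit.SiegelDoubled
open Summit.HodgeConjecture.HodgeConjecture.Cruxes.HLiu418.K2LiuKlingenParabolicDefs
open Summit.HodgeConjecture.HodgeConjecture.Cruxes.HLiu418.K2LiuKlingenUnipotentAdelicDefs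
open Summit.HodgeConjecture.HodgeConjecture.Cruxes.HLiu418.K2LiuSiegelDoubledLeviMatrix (conjAdele_conjAdele')
open Summit.HodgeConjecture.HodgeConjecture.Cruxes.HLiu418.K2LiuKlingenInnerSectionLocalDefs
open Summit.HodgeConjecture.HodgeConjecture.Cruxes.HLiu418.K2LiuKlingenInnerSectionLocalTransport
open Summit.HodgeConjecture.HodgeConjecture.Cruxes.HLiu418.K2LiuKlingenInnerSectionShape
open Summit.HodgeConjecture.HodgeConjecture.Cruxes.HLiu418.K2LiuKlingenInnerSectionShapeArch
open Summit.HodgeConjecture.HodgeConjecture.Cruxes.HLiu418.K2LiuKlingenFibreLocalCoordinates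

variable (L : Type) [Field L] [NumberField L] [IsCMField L]

/-! ## §1 The `T′`-quadratic coordinates determine the natural local components -/

/-- **`(Ψ⁻¹y)₂|_v, (Ψ⁻¹t)₁|_v, (Ψ⁻¹t)₂|_v` DETERMINE `(y_v, t_v)`** for skew `y ∈ Y`: the local bridge `θ_v` of ★ `exists_localCoord` sends the quadratic `v`-coordinates
of `(y, t)` to `(adeleToLocal v y, adeleToLocal v t)` (clause L2). [cite: CasselsFrohlichANT1967, Ch. II §10] -/
theorem adeleToLocal_eq_of_quadCoords_eq {δ : L} (hσδ : IsCMField.complexConj L δ = -δ) (hδ : δ ≠ 0)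
    (Y : AddSubgroup (AdeleRing (𝓞 L) L)) (hY : ∀ y, y ∈ Y ↔ conjAdele (Fp L) L (IsCMField.complexConj L) y = -y)
    (v : HeightOneSpectrum (𝓞 (Fp L))) (y y' : ↥Y) (t t' : AdeleRing (𝓞 L) L)
    (h : haveI : Algebra.IsQuadraticExtension (Fp L) L := IsCMField.isQuadraticExtension L
      (![((quadraticAdeleEquiv (Fp L) L (IsCMField.complexConj L) hσδ hδ).symm (y : AdeleRing (𝓞 L) L)).2.2 v,
          ((quadraticAdeleEquiv (Fp L) L (IsCMField.complexConj L) hσδ hδ).symm t).1.2 v,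
          ((quadraticAdeleEquiv (Fp L) L (IsCMField.complexConj L) hσδ hδ).symm t).2.2 v] : Fin 3 → v.adicCompletion (Fp L)) =
        ![((quadraticAdeleEquiv (Fp L) L (IsCMField.complexConj L) hσδ hδ).symm (y' : AdeleRing (𝓞 L) L)).2.2 v,
          ((quadraticAdeleEquiv (Fp L) L (IsCMField.complexConj L) hσδ hδ).symm t').1.2 v,
          ((quadraticAdeleEquiv (Fp L) L (IsCMField.complexConj L) hσδ hδ).symm t').2.2 v]) :
    adeleToLocal L v (y : AdeleRing (𝓞 L) L) = adeleToLocal L v (y' : AdeleRing (𝓞 L) L) ∧ adeleToLocal L v t = adeleToLocal L v t' := by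
  haveI : Algebra.IsQuadraticExtension (Fp L) L := IsCMField.isQuadraticExtension L
  obtain ⟨θ, -, -, -, hθL2, -⟩ := exists_localCoord L v hσδ hδ (skewLoc L v) (mem_skewLoc_iff L v)
  have e := hθL2 Y hY y t
  have e' := hθL2 Y hY y' t'
  rw [h, e'] at e
  exact ⟨(congrArg Subtype.val (Prod.ext_iff.1 e).1).symm, (Prod.ext_iff.1 e).2.symm⟩

/-- proof-irrelevant congruence of the local term-2 argument `Ψ_v(ξ_v · n_{Q,v}(y, z, t) · m) · x` in `(y, t)`. [cite: Xiong2013, §7 Lemma 7.1] -/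
theorem localArg_congr (v : HeightOneSpectrum (𝓞 (Fp L))) {N' : ℕ} {J' : Matrix (Fin N') (Fin N') L}
    (Ψv : UnitaryGroup.localPi L (IsCMField.complexConj L) 4 ((StdForm.antidiagonal 4).over L) v →* UnitaryGroup.localPi L (IsCMField.complexConj L) N' J' v)
    {y y' : LocalRing L v} (hy : y = y') (py : conjLocal L (IsCMField.complexConj L) v y = -y) (py' : conjLocal L (IsCMField.complexConj L) v y' = -y')
    {t t' : LocalRing L v} (ht : t = t') (z : LocalRing L v)
    (m : UnitaryGroup.localPi L (IsCMField.complexConj L) 4 ((StdForm.antidiagonal 4).over L) v) (x : UnitaryGroup.localPi L (IsCMField.complexConj L) N' J' v) :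
    Ψv (weylXiLoc L v * nKlingenLoc L v y py z t * m) * x = Ψv (weylXiLoc L v * nKlingenLoc L v y' py' z t' * m) * x := by
  subst hy ht; rfl

/-- congruence of the local term-2 argument `Ψ_v(ξ_v · n · m_{Q,v}(1, g)) · x` in `g`. [cite: Xiong2013, §7 Lemma 7.1] -/
theorem localArg_congr_levi (v : HeightOneSpectrum (𝓞 (Fp L))) {N' : ℕ} {J' : Matrix (Fin N') (Fin N') L}
    (Ψv : UnitaryGroup.localPi L (IsCMField.complexConj L) 4 ((StdForm.antidiagonal 4).over L) v →* UnitaryGroup.localPi L (IsCMField.complexConj L) N' J' v)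
    (n : UnitaryGroup.localPi L (IsCMField.complexConj L) 4 ((StdForm.antidiagonal 4).over L) v)
    {g g' : UnitaryGroup.localPi L (IsCMField.complexConj L) 2 ((StdForm.antidiagonal 2).over L) v} (hg : g = g')
    (x : UnitaryGroup.localPi L (IsCMField.complexConj L) N' J' v) :
    Ψv (weylXiLoc L v * n * klingenLeviLoc L v 1 g) * x = Ψv (weylXiLoc L v * n * klingenLeviLoc L v 1 g') * x := by
  subst hg; rfl

/-! ### The place-`v` letter of the term-2 argument, in ★ B's currency (`Ψ : U(J₄)(𝔸) →* U(J′)(𝔸)`, `N = 4`, generic `J′`) -/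

section Letters

variable {J' : Matrix (Fin 4) (Fin 4) L}
  (Ψ : (adelicGroupData (Fp L) L (IsCMField.complexConj L) 4 ((StdForm.antidiagonal 4).over L)).Adelic →*
    (adelicGroupData (Fp L) L (IsCMField.complexConj L) 4 J').Adelic)
  (SA : GL (Fin 4) (AdeleRing (𝓞 L) L))
  (hΨ : ∀ g : (adelicGroupData (Fp L) L (IsCMField.complexConj L) 4 ((StdForm.antidiagonal 4).over L)).Adelic,
    (((Ψ g).1 : GL (Fin 4) (AdeleRing (𝓞 L) L)) : Matrix (Fin 4) (Fin 4) (AdeleRing (𝓞 L) L)) =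
      (SA : Matrix (Fin 4) (Fin 4) (AdeleRing (𝓞 L) L)) *
        ((adelicVal (Fp L) L (IsCMField.complexConj L) 4 ((StdForm.antidiagonal 4).over L) g : GL (Fin 4) (AdeleRing (𝓞 L) L)) :
          Matrix (Fin 4) (Fin 4) (AdeleRing (𝓞 L) L)) *
        ((SA⁻¹ : GL (Fin 4) (AdeleRing (𝓞 L) L)) : Matrix (Fin 4) (Fin 4) (AdeleRing (𝓞 L) L)))
  (v : HeightOneSpectrum (𝓞 (Fp L)))
include hΨ in
/-- ★ B `evalPlace_finPart_letters` with the literal `0_v` in the `z`-slot (`adeleToLocal v 0 = 0`): the `v`-component of the term-2 argument is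
`Ψ_v(ξ_v · n_{Q,v}(y_v, 0, t_v) · m_{Q,v}(1,(g₂)_v)) · h_v`. [cite: BorelJacquet1979, §4.1] [cite: MoeglinWaldspurger1995, II.1.7] -/
theorem evalPlace_finPart_letters_zero (y : AdeleRing (𝓞 L) L) (hy : conjAdele (Fp L) L (IsCMField.complexConj L) y = -y) (t : AdeleRing (𝓞 L) L)
    (g₂ : (quasiSplit (Fp L) L (IsCMField.complexConj L) 2).Adelic) (h : (adelicGroupData (Fp L) L (IsCMField.complexConj L) 4 J').Adelic) :
    UnitaryGroup.evalPlace (Fp L) L (IsCMField.complexConj L) 4 J' v (UnitaryGroup.finPart (Fp L) L (IsCMField.complexConj L) 4 J'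
        (Ψ (jAdelic L 4 (weylXi (AdeleRing (𝓞 L) L) (conjAdele (Fp L) L (IsCMField.complexConj L)))) *
          Ψ (jAdelic L 4 (nKlingen (AdeleRing (𝓞 L) L) (conjAdele (Fp L) L (IsCMField.complexConj L)) (conjAdele_conjAdele' L) y hy 0 t)) *
          (Ψ (jAdelic L 4 (klingenLevi (AdeleRing (𝓞 L) L) (conjAdele (Fp L) L (IsCMField.complexConj L)) (conjAdele_conjAdele' L) 1 ((jAdelic L 2).symm g₂))) * h))) =
      psiLoc L Ψ v (weylXiLoc L v * nKlingenLoc L v (adeleToLocal L v y) ((mem_skewLoc_iff L v _).1 (adeleToLocal_mem_skewLoc L v hy)) 0 (adeleToLocal L v t) *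
          klingenLeviLoc L v 1 (UnitaryGroup.evalPlace (Fp L) L (IsCMField.complexConj L) 2 ((StdForm.antidiagonal 2).over L) v
            (UnitaryGroup.finPart (Fp L) L (IsCMField.complexConj L) 2 ((StdForm.antidiagonal 2).over L) g₂))) *
        UnitaryGroup.evalPlace (Fp L) L (IsCMField.complexConj L) 4 J' v (UnitaryGroup.finPart (Fp L) L (IsCMField.complexConj L) 4 J' h) := by
  rw [evalPlace_finPart_letters L Ψ SA hΨ v y hy t g₂ h, map_zero]
include hΨ in
/-- **the `v`-component of the term-2 argument depends on `(y, t)` only through `(y_v, t_v)`.** [cite: BorelJacquet1979, §4.1] -/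
theorem evalPlace_finPart_arg_congr {y y' : AdeleRing (𝓞 L) L} (hy : conjAdele (Fp L) L (IsCMField.complexConj L) y = -y)
    (hy' : conjAdele (Fp L) L (IsCMField.complexConj L) y' = -y') {t t' : AdeleRing (𝓞 L) L}
    (hyv : adeleToLocal L v y = adeleToLocal L v y') (htv : adeleToLocal L v t = adeleToLocal L v t')
    (g₂ : (quasiSplit (Fp L) L (IsCMField.complexConj L) 2).Adelic) (h : (adelicGroupData (Fp L) L (IsCMField.complexConj L) 4 J').Adelic) :
    UnitaryGroup.evalPlace (Fp L) L (IsCMField.complexConj L) 4 J' v (UnitaryGroup.finPart (Fp L) L (IsCMField.complexConj L) 4 J'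
        (Ψ (jAdelic L 4 (weylXi (AdeleRing (𝓞 L) L) (conjAdele (Fp L) L (IsCMField.complexConj L)))) *
          Ψ (jAdelic L 4 (nKlingen (AdeleRing (𝓞 L) L) (conjAdele (Fp L) L (IsCMField.complexConj L)) (conjAdele_conjAdele' L) y hy 0 t)) *
          (Ψ (jAdelic L 4 (klingenLevi (AdeleRing (𝓞 L) L) (conjAdele (Fp L) L (IsCMField.complexConj L)) (conjAdele_conjAdele' L) 1 ((jAdelic L 2).symm g₂))) * h))) =
    UnitaryGroup.evalPlace (Fp L) L (IsCMField.complexConj L) 4 J' v (UnitaryGroup.finPart (Fp L) L (IsCMField.complexConj L) 4 J'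
        (Ψ (jAdelic L 4 (weylXi (AdeleRing (𝓞 L) L) (conjAdele (Fp L) L (IsCMField.complexConj L)))) *
          Ψ (jAdelic L 4 (nKlingen (AdeleRing (𝓞 L) L) (conjAdele (Fp L) L (IsCMField.complexConj L)) (conjAdele_conjAdele' L) y' hy' 0 t')) *
          (Ψ (jAdelic L 4 (klingenLevi (AdeleRing (𝓞 L) L) (conjAdele (Fp L) L (IsCMField.complexConj L)) (conjAdele_conjAdele' L) 1 ((jAdelic L 2).symm g₂))) * h))) := by
  rw [evalPlace_finPart_letters L Ψ SA hΨ v y hy t g₂ h, evalPlace_finPart_letters L Ψ SA hΨ v y' hy' t' g₂ h]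
  exact localArg_congr L v _ hyv _ _ htv _ _ _
include hΨ in
/-- **the `v`-component of the term-2 argument depends on `g₂` only through `(g₂)_v`.** [cite: BorelJacquet1979, §4.1] -/
theorem evalPlace_finPart_arg_congr_levi (y : AdeleRing (𝓞 L) L) (hy : conjAdele (Fp L) L (IsCMField.complexConj L) y = -y) (t : AdeleRing (𝓞 L) L)
    {g₂ g₂' : (quasiSplit (Fp L) L (IsCMField.complexConj L) 2).Adelic}
    (hg : UnitaryGroup.evalPlace (Fp L) L (IsCMField.complexConj L) 2 ((StdForm.antidiagonal 2).over L) v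
        (UnitaryGroup.finPart (Fp L) L (IsCMField.complexConj L) 2 ((StdForm.antidiagonal 2).over L) g₂) =
      UnitaryGroup.evalPlace (Fp L) L (IsCMField.complexConj L) 2 ((StdForm.antidiagonal 2).over L) v
        (UnitaryGroup.finPart (Fp L) L (IsCMField.complexConj L) 2 ((StdForm.antidiagonal 2).over L) g₂'))
    (h : (adelicGroupData (Fp L) L (IsCMField.complexConj L) 4 J').Adelic) :
    UnitaryGroup.evalPlace (Fp L) L (IsCMField.complexConj L) 4 J' v (UnitaryGroup.finPart (Fp L) L (IsCMField.complexConj L) 4 J'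
        (Ψ (jAdelic L 4 (weylXi (AdeleRing (𝓞 L) L) (conjAdele (Fp L) L (IsCMField.complexConj L)))) *
          Ψ (jAdelic L 4 (nKlingen (AdeleRing (𝓞 L) L) (conjAdele (Fp L) L (IsCMField.complexConj L)) (conjAdele_conjAdele' L) y hy 0 t)) *
          (Ψ (jAdelic L 4 (klingenLevi (AdeleRing (𝓞 L) L) (conjAdele (Fp L) L (IsCMField.complexConj L)) (conjAdele_conjAdele' L) 1 ((jAdelic L 2).symm g₂))) * h))) =
    UnitaryGroup.evalPlace (Fp L) L (IsCMField.complexConj L) 4 J' v (UnitaryGroup.finPart (Fp L) L (IsCMField.complexConj L) 4 J'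
        (Ψ (jAdelic L 4 (weylXi (AdeleRing (𝓞 L) L) (conjAdele (Fp L) L (IsCMField.complexConj L)))) *
          Ψ (jAdelic L 4 (nKlingen (AdeleRing (𝓞 L) L) (conjAdele (Fp L) L (IsCMField.complexConj L)) (conjAdele_conjAdele' L) y hy 0 t)) *
          (Ψ (jAdelic L 4 (klingenLevi (AdeleRing (𝓞 L) L) (conjAdele (Fp L) L (IsCMField.complexConj L)) (conjAdele_conjAdele' L) 1 ((jAdelic L 2).symm g₂'))) * h))) := by
  rw [evalPlace_finPart_letters L Ψ SA hΨ v y hy t g₂ h, evalPlace_finPart_letters L Ψ SA hΨ v y hy t g₂' h]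
  exact localArg_congr_levi L v _ _ hg _

end Letters

/-! ## §2 The `T′`-part of the term-2 integrand factors through the natural key -/

section Tensor

variable {N M : ℕ} {e : Fin N × Fin M ≃ Fin 2}
  {dV : Fin N → L} {hdV : ∀ i, IsCMField.complexConj L (dV i) = dV i}
  {dW : Fin M → L} {hdW : ∀ i, IsCMField.complexConj L (dW i) = dW i}
  (Ψ : (adelicGroupData (Fp L) L (IsCMField.complexConj L) 4 ((StdForm.antidiagonal 4).over L)).Adelic →* HA L e dV hdV dW hdW)
  (SA : GL (Fin 4) (AdeleRing (𝓞 L) L))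
  (hΨ : ∀ g : (adelicGroupData (Fp L) L (IsCMField.complexConj L) 4 ((StdForm.antidiagonal 4).over L)).Adelic,
    (((Ψ g).1 : GL (Fin 4) (AdeleRing (𝓞 L) L)) : Matrix (Fin 4) (Fin 4) (AdeleRing (𝓞 L) L)) =
      (SA : Matrix (Fin 4) (Fin 4) (AdeleRing (𝓞 L) L)) *
        ((adelicVal (Fp L) L (IsCMField.complexConj L) 4 ((StdForm.antidiagonal 4).over L) g : GL (Fin 4) (AdeleRing (𝓞 L) L)) :
          Matrix (Fin 4) (Fin 4) (AdeleRing (𝓞 L) L)) *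
        ((SA⁻¹ : GL (Fin 4) (AdeleRing (𝓞 L) L)) : Matrix (Fin 4) (Fin 4) (AdeleRing (𝓞 L) L)))
  {δ : L} (hσδ : IsCMField.complexConj L δ = -δ) (hδ : δ ≠ 0)
  (Y : AddSubgroup (AdeleRing (𝓞 L) L)) (hY : ∀ y, y ∈ Y ↔ conjAdele (Fp L) L (IsCMField.complexConj L) y = -y)
  (T' : Finset (HeightOneSpectrum (𝓞 (Fp L))))
  (fT : ℂ → UnitaryGroup.arch (Fp L) L (IsCMField.complexConj L) (2 + 2) (hermD L e dV hdV dW hdW) ×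
    (Π v : T', UnitaryGroup.localPi L (IsCMField.complexConj L) (2 + 2) (hermD L e dV hdV dW hdW) v.1) → ℂ)
  (h : HA L e dV hdV dW hdW)
set_option simprocs false in -- `dsimp only` below must be pure β∕η∕proj: the `Nat` simprocs would rewrite the numerals `2 + 2` inside the currency (measured time-outs)
include hΨ in
/-- **THE `T′`-PART FACTORS THROUGH THE NATURAL KEY**: `q ↦ fT_s(archPart(arg_{g₂} q), ((arg_{g₂} q)_v)_{v∈T′})` takes equal values at `q, q′` with
`(y_∞, t_∞) = (y′_∞, t′_∞)` and equal `T′`-quadratic coordinates (★ E-1 `archPart_arg_eq_of_fst_eq`; ★ B `evalPlace_finPart_letters` + §1).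
[cite: BorelJacquet1979, §4.1] [cite: CasselsFrohlichANT1967, Ch. II §10, §14] -/
theorem tensor_factorsThrough (s : ℂ) (g₂ : (quasiSplit (Fp L) L (IsCMField.complexConj L) 2).Adelic) :
    haveI : Algebra.IsQuadraticExtension (Fp L) L := IsCMField.isQuadraticExtension L
    Function.FactorsThrough
      (fun q : ↥Y × AdeleRing (𝓞 L) L =>
        fT s (UnitaryGroup.archPart (Fp L) L (IsCMField.complexConj L) (2 + 2) (hermD L e dV hdV dW hdW)
                (Ψ (jAdelic L 4 (weylXi (AdeleRing (𝓞 L) L) (conjAdele (Fp L) L (IsCMField.complexConj L)))) *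
                  Ψ (jAdelic L 4 (nKlingen (AdeleRing (𝓞 L) L) (conjAdele (Fp L) L (IsCMField.complexConj L)) (conjAdele_conjAdele' L)
                    (((q.1 : ↥Y) : AdeleRing (𝓞 L) L)) ((hY _).1 q.1.2) 0 q.2)) *
                  (Ψ (jAdelic L 4 (klingenLevi (AdeleRing (𝓞 L) L) (conjAdele (Fp L) L (IsCMField.complexConj L)) (conjAdele_conjAdele' L) 1 ((jAdelic L 2).symm g₂))) * h)),
              fun v : T' => UnitaryGroup.evalPlace (Fp L) L (IsCMField.complexConj L) (2 + 2) (hermD L e dV hdV dW hdW) v.1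
                (UnitaryGroup.finPart (Fp L) L (IsCMField.complexConj L) (2 + 2) (hermD L e dV hdV dW hdW)
                  (Ψ (jAdelic L 4 (weylXi (AdeleRing (𝓞 L) L) (conjAdele (Fp L) L (IsCMField.complexConj L)))) *
                    Ψ (jAdelic L 4 (nKlingen (AdeleRing (𝓞 L) L) (conjAdele (Fp L) L (IsCMField.complexConj L)) (conjAdele_conjAdele' L)
                      (((q.1 : ↥Y) : AdeleRing (𝓞 L) L)) ((hY _).1 q.1.2) 0 q.2)) *
                    (Ψ (jAdelic L 4 (klingenLevi (AdeleRing (𝓞 L) L) (conjAdele (Fp L) L (IsCMField.complexConj L)) (conjAdele_conjAdele' L) 1 ((jAdelic L 2).symm g₂))) * h)))))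
      (fun q : ↥Y × AdeleRing (𝓞 L) L =>
        ((((q.1 : AdeleRing (𝓞 L) L)).1, q.2.1),
          fun v : T' => (![((quadraticAdeleEquiv (Fp L) L (IsCMField.complexConj L) hσδ hδ).symm (q.1 : AdeleRing (𝓞 L) L)).2.2 v.1,
            ((quadraticAdeleEquiv (Fp L) L (IsCMField.complexConj L) hσδ hδ).symm q.2).1.2 v.1,
            ((quadraticAdeleEquiv (Fp L) L (IsCMField.complexConj L) hσδ hδ).symm q.2).2.2 v.1] : Fin 3 → v.1.adicCompletion (Fp L)))) := by
  haveI : Algebra.IsQuadraticExtension (Fp L) L := IsCMField.isQuadraticExtension L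
  intro q q' hqq
  obtain ⟨h1, h2⟩ := Prod.ext_iff.1 hqq
  obtain ⟨hy1, ht1⟩ := Prod.ext_iff.1 h1
  dsimp only at hy1 ht1 h2 ⊢
  refine congrArg (fT s) (Prod.ext ?_ (funext fun v => ?_))
  · -- the archimedean letter (★ E-1)
    exact archPart_arg_eq_of_fst_eq L Ψ SA hΨ ((hY _).1 q.1.2) ((hY _).1 q'.1.2) hy1 ht1 _ _
  · -- the `T′`-letters (★ B + §1)
    obtain ⟨hyv, htv⟩ := adeleToLocal_eq_of_quadCoords_eq L hσδ hδ Y hY v.1 q.1 q'.1 q.2 q'.2 (congrFun h2 v)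
    dsimp only
    exact evalPlace_finPart_arg_congr L Ψ SA hΨ v.1 ((hY _).1 q.1.2) ((hY _).1 q'.1.2) hyv htv g₂ h
set_option simprocs false in -- as above
include hΨ in
/-- **THE `T′`-PART DEPENDS ON `g₂` ONLY THROUGH `(archPart g₂, ((g₂)_v)_{v∈T′})`** (★ E-1b `archPart_arg_eq_of_archPart_eq`; ★ B `evalPlace_finPart_letters`).
[cite: BorelJacquet1979, §4.1] [cite: MoeglinWaldspurger1995, II.1.7] -/
theorem tensor_eq_of_archPart_eq (s : ℂ) {g₂ g₂' : (quasiSplit (Fp L) L (IsCMField.complexConj L) 2).Adelic}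
    (ha : UnitaryGroup.archPart (Fp L) L (IsCMField.complexConj L) 2 ((StdForm.antidiagonal 2).over L) g₂ =
      UnitaryGroup.archPart (Fp L) L (IsCMField.complexConj L) 2 ((StdForm.antidiagonal 2).over L) g₂')
    (hT : ∀ v : T', UnitaryGroup.evalPlace (Fp L) L (IsCMField.complexConj L) 2 ((StdForm.antidiagonal 2).over L) v.1
        (UnitaryGroup.finPart (Fp L) L (IsCMField.complexConj L) 2 ((StdForm.antidiagonal 2).over L) g₂) =
      UnitaryGroup.evalPlace (Fp L) L (IsCMField.complexConj L) 2 ((StdForm.antidiagonal 2).over L) v.1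
        (UnitaryGroup.finPart (Fp L) L (IsCMField.complexConj L) 2 ((StdForm.antidiagonal 2).over L) g₂'))
    (q : ↥Y × AdeleRing (𝓞 L) L) :
    fT s (UnitaryGroup.archPart (Fp L) L (IsCMField.complexConj L) (2 + 2) (hermD L e dV hdV dW hdW)
            (Ψ (jAdelic L 4 (weylXi (AdeleRing (𝓞 L) L) (conjAdele (Fp L) L (IsCMField.complexConj L)))) *
              Ψ (jAdelic L 4 (nKlingen (AdeleRing (𝓞 L) L) (conjAdele (Fp L) L (IsCMField.complexConj L)) (conjAdele_conjAdele' L)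
                (((q.1 : ↥Y) : AdeleRing (𝓞 L) L)) ((hY _).1 q.1.2) 0 q.2)) *
              (Ψ (jAdelic L 4 (klingenLevi (AdeleRing (𝓞 L) L) (conjAdele (Fp L) L (IsCMField.complexConj L)) (conjAdele_conjAdele' L) 1 ((jAdelic L 2).symm g₂))) * h)),
          fun v : T' => UnitaryGroup.evalPlace (Fp L) L (IsCMField.complexConj L) (2 + 2) (hermD L e dV hdV dW hdW) v.1
            (UnitaryGroup.finPart (Fp L) L (IsCMField.complexConj L) (2 + 2) (hermD L e dV hdV dW hdW)
              (Ψ (jAdelic L 4 (weylXi (AdeleRing (𝓞 L) L) (conjAdele (Fp L) L (IsCMField.complexConj L)))) *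
                Ψ (jAdelic L 4 (nKlingen (AdeleRing (𝓞 L) L) (conjAdele (Fp L) L (IsCMField.complexConj L)) (conjAdele_conjAdele' L)
                  (((q.1 : ↥Y) : AdeleRing (𝓞 L) L)) ((hY _).1 q.1.2) 0 q.2)) *
                (Ψ (jAdelic L 4 (klingenLevi (AdeleRing (𝓞 L) L) (conjAdele (Fp L) L (IsCMField.complexConj L)) (conjAdele_conjAdele' L) 1 ((jAdelic L 2).symm g₂))) * h)))) =
      fT s (UnitaryGroup.archPart (Fp L) L (IsCMField.complexConj L) (2 + 2) (hermD L e dV hdV dW hdW)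
            (Ψ (jAdelic L 4 (weylXi (AdeleRing (𝓞 L) L) (conjAdele (Fp L) L (IsCMField.complexConj L)))) *
              Ψ (jAdelic L 4 (nKlingen (AdeleRing (𝓞 L) L) (conjAdele (Fp L) L (IsCMField.complexConj L)) (conjAdele_conjAdele' L)
                (((q.1 : ↥Y) : AdeleRing (𝓞 L) L)) ((hY _).1 q.1.2) 0 q.2)) *
              (Ψ (jAdelic L 4 (klingenLevi (AdeleRing (𝓞 L) L) (conjAdele (Fp L) L (IsCMField.complexConj L)) (conjAdele_conjAdele' L) 1 ((jAdelic L 2).symm g₂'))) * h)),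
          fun v : T' => UnitaryGroup.evalPlace (Fp L) L (IsCMField.complexConj L) (2 + 2) (hermD L e dV hdV dW hdW) v.1
            (UnitaryGroup.finPart (Fp L) L (IsCMField.complexConj L) (2 + 2) (hermD L e dV hdV dW hdW)
              (Ψ (jAdelic L 4 (weylXi (AdeleRing (𝓞 L) L) (conjAdele (Fp L) L (IsCMField.complexConj L)))) *
                Ψ (jAdelic L 4 (nKlingen (AdeleRing (𝓞 L) L) (conjAdele (Fp L) L (IsCMField.complexConj L)) (conjAdele_conjAdele' L)
                  (((q.1 : ↥Y) : AdeleRing (𝓞 L) L)) ((hY _).1 q.1.2) 0 q.2)) *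
                (Ψ (jAdelic L 4 (klingenLevi (AdeleRing (𝓞 L) L) (conjAdele (Fp L) L (IsCMField.complexConj L)) (conjAdele_conjAdele' L) 1 ((jAdelic L 2).symm g₂'))) * h)))) := by
  refine congrArg (fT s) (Prod.ext ?_ (funext fun v => ?_))
  · -- the archimedean letter (★ E-1b)
    exact archPart_arg_eq_of_archPart_eq L Ψ SA hΨ ha _ _
  · -- the `T′`-letters (★ B)
    dsimp only
    exact evalPlace_finPart_arg_congr_levi L Ψ SA hΨ v.1 _ ((hY _).1 q.1.2) q.2 (hT v) h

/-! ## §3 The `T′`-tensor on the natural key space and the shape `hF` of ★ E-D0 -/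
include hΨ in
/-- **THE `T′`-TENSOR `gN`** on the key space `X_{T′} = (L_∞ × L_∞) × Π_{v∈T′} (L⁺_v)³`: `∃ gN : ℂ → U(J₂)(𝔸) → X_{T′} → ℂ` with
(i) `fT_s(archPart(arg_{g₂} q), ((arg_{g₂} q)_v)_{v∈T′}) = gN s g₂ (π q)` for every `q = (y, t)`, `π q = ((y_∞, t_∞), T′-quadratic coordinates)`, and
(ii) `gN s g₂ = gN s g₂'` whenever `archPart g₂ = archPart g₂'` and `(g₂)_v = (g₂')_v` for `v ∈ T′` (`Function.extend` along `π`, §2).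
[cite: BorelJacquet1979, §4.1] [cite: CasselsFrohlichANT1967, Ch. II §14] [cite: MoeglinWaldspurger1995, II.1.7] -/
theorem exists_tensor :
    haveI : Algebra.IsQuadraticExtension (Fp L) L := IsCMField.isQuadraticExtension L
    ∃ gN : ℂ → (quasiSplit (Fp L) L (IsCMField.complexConj L) 2).Adelic →
        (InfiniteAdeleRing L × InfiniteAdeleRing L) × (Π v : T', Fin 3 → v.1.adicCompletion (Fp L)) → ℂ,
      (∀ (s : ℂ) (g₂ : (quasiSplit (Fp L) L (IsCMField.complexConj L) 2).Adelic) (q : ↥Y × AdeleRing (𝓞 L) L),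
        fT s (UnitaryGroup.archPart (Fp L) L (IsCMField.complexConj L) (2 + 2) (hermD L e dV hdV dW hdW)
                (Ψ (jAdelic L 4 (weylXi (AdeleRing (𝓞 L) L) (conjAdele (Fp L) L (IsCMField.complexConj L)))) *
                  Ψ (jAdelic L 4 (nKlingen (AdeleRing (𝓞 L) L) (conjAdele (Fp L) L (IsCMField.complexConj L)) (conjAdele_conjAdele' L)
                    (((q.1 : ↥Y) : AdeleRing (𝓞 L) L)) ((hY _).1 q.1.2) 0 q.2)) *
                  (Ψ (jAdelic L 4 (klingenLevi (AdeleRing (𝓞 L) L) (conjAdele (Fp L) L (IsCMField.complexConj L)) (conjAdele_conjAdele' L) 1 ((jAdelic L 2).symm g₂))) * h)),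
              fun v : T' => UnitaryGroup.evalPlace (Fp L) L (IsCMField.complexConj L) (2 + 2) (hermD L e dV hdV dW hdW) v.1
                (UnitaryGroup.finPart (Fp L) L (IsCMField.complexConj L) (2 + 2) (hermD L e dV hdV dW hdW)
                  (Ψ (jAdelic L 4 (weylXi (AdeleRing (𝓞 L) L) (conjAdele (Fp L) L (IsCMField.complexConj L)))) *
                    Ψ (jAdelic L 4 (nKlingen (AdeleRing (𝓞 L) L) (conjAdele (Fp L) L (IsCMField.complexConj L)) (conjAdele_conjAdele' L)
                      (((q.1 : ↥Y) : AdeleRing (𝓞 L) L)) ((hY _).1 q.1.2) 0 q.2)) *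
                    (Ψ (jAdelic L 4 (klingenLevi (AdeleRing (𝓞 L) L) (conjAdele (Fp L) L (IsCMField.complexConj L)) (conjAdele_conjAdele' L) 1 ((jAdelic L 2).symm g₂))) * h)))) =
          gN s g₂ ((((q.1 : AdeleRing (𝓞 L) L)).1, q.2.1),
            fun v : T' => ![((quadraticAdeleEquiv (Fp L) L (IsCMField.complexConj L) hσδ hδ).symm (q.1 : AdeleRing (𝓞 L) L)).2.2 v.1,
              ((quadraticAdeleEquiv (Fp L) L (IsCMField.complexConj L) hσδ hδ).symm q.2).1.2 v.1,
              ((quadraticAdeleEquiv (Fp L) L (IsCMField.complexConj L) hσδ hδ).symm q.2).2.2 v.1])) ∧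
      (∀ (s : ℂ) (g₂ g₂' : (quasiSplit (Fp L) L (IsCMField.complexConj L) 2).Adelic),
        UnitaryGroup.archPart (Fp L) L (IsCMField.complexConj L) 2 ((StdForm.antidiagonal 2).over L) g₂ =
          UnitaryGroup.archPart (Fp L) L (IsCMField.complexConj L) 2 ((StdForm.antidiagonal 2).over L) g₂' →
        (∀ v : T', UnitaryGroup.evalPlace (Fp L) L (IsCMField.complexConj L) 2 ((StdForm.antidiagonal 2).over L) v.1
            (UnitaryGroup.finPart (Fp L) L (IsCMField.complexConj L) 2 ((StdForm.antidiagonal 2).over L) g₂) =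
          UnitaryGroup.evalPlace (Fp L) L (IsCMField.complexConj L) 2 ((StdForm.antidiagonal 2).over L) v.1
            (UnitaryGroup.finPart (Fp L) L (IsCMField.complexConj L) 2 ((StdForm.antidiagonal 2).over L) g₂')) →
        gN s g₂ = gN s g₂') := by
  classical
  haveI : Algebra.IsQuadraticExtension (Fp L) L := IsCMField.isQuadraticExtension L
  refine ⟨fun s g₂ => Function.extend
      (fun q : ↥Y × AdeleRing (𝓞 L) L =>
        ((((q.1 : AdeleRing (𝓞 L) L)).1, q.2.1),
          fun v : T' => (![((quadraticAdeleEquiv (Fp L) L (IsCMField.complexConj L) hσδ hδ).symm (q.1 : AdeleRing (𝓞 L) L)).2.2 v.1,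
            ((quadraticAdeleEquiv (Fp L) L (IsCMField.complexConj L) hσδ hδ).symm q.2).1.2 v.1,
            ((quadraticAdeleEquiv (Fp L) L (IsCMField.complexConj L) hσδ hδ).symm q.2).2.2 v.1] : Fin 3 → v.1.adicCompletion (Fp L))))
      (fun q : ↥Y × AdeleRing (𝓞 L) L =>
        fT s (UnitaryGroup.archPart (Fp L) L (IsCMField.complexConj L) (2 + 2) (hermD L e dV hdV dW hdW)
                (Ψ (jAdelic L 4 (weylXi (AdeleRing (𝓞 L) L) (conjAdele (Fp L) L (IsCMField.complexConj L)))) *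
                  Ψ (jAdelic L 4 (nKlingen (AdeleRing (𝓞 L) L) (conjAdele (Fp L) L (IsCMField.complexConj L)) (conjAdele_conjAdele' L)
                    (((q.1 : ↥Y) : AdeleRing (𝓞 L) L)) ((hY _).1 q.1.2) 0 q.2)) *
                  (Ψ (jAdelic L 4 (klingenLevi (AdeleRing (𝓞 L) L) (conjAdele (Fp L) L (IsCMField.complexConj L)) (conjAdele_conjAdele' L) 1 ((jAdelic L 2).symm g₂))) * h)),
              fun v : T' => UnitaryGroup.evalPlace (Fp L) L (IsCMField.complexConj L) (2 + 2) (hermD L e dV hdV dW hdW) v.1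
                (UnitaryGroup.finPart (Fp L) L (IsCMField.complexConj L) (2 + 2) (hermD L e dV hdV dW hdW)
                  (Ψ (jAdelic L 4 (weylXi (AdeleRing (𝓞 L) L) (conjAdele (Fp L) L (IsCMField.complexConj L)))) *
                    Ψ (jAdelic L 4 (nKlingen (AdeleRing (𝓞 L) L) (conjAdele (Fp L) L (IsCMField.complexConj L)) (conjAdele_conjAdele' L)
                      (((q.1 : ↥Y) : AdeleRing (𝓞 L) L)) ((hY _).1 q.1.2) 0 q.2)) *
                    (Ψ (jAdelic L 4 (klingenLevi (AdeleRing (𝓞 L) L) (conjAdele (Fp L) L (IsCMField.complexConj L)) (conjAdele_conjAdele' L) 1 ((jAdelic L 2).symm g₂))) * h)))))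
      0, fun s g₂ q => ?_, fun s g₂ g₂' ha hT => ?_⟩
  · exact ((tensor_factorsThrough L Ψ SA hΨ hσδ hδ Y hY T' fT h s g₂).extend_apply _ q).symm
  · funext x
    exact congrFun (congrArg (fun G : ↥Y × AdeleRing (𝓞 L) L → ℂ =>
        Function.extend (β := (InfiniteAdeleRing L × InfiniteAdeleRing L) × (Π v : T', Fin 3 → v.1.adicCompletion (Fp L))) _ G 0)
      (funext fun q => tensor_eq_of_archPart_eq L Ψ SA hΨ Y hY T' fT h s ha hT q)) x
include hΨ in
/-- **the local factor at `v ∉ T′` read in ★ B's letters**: `Λ_{s,v}((arg_{g₂}(y,t))_v) = Λ_{s,v}(Ψ_v(ξ_v · n_{Q,v}(y_v, 0, t_v) · m_{Q,v}(1,(g₂)_v)) · h_v)`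
(`evalPlace_finPart_letters_zero`, read in the `H(𝔸)`-currency of ★ #31s `IsFactorizableOff`). [cite: BorelJacquet1979, §4.1] [cite: Liu2011, §2B p. 862] -/
theorem local_factor_eq (χ : HeckeCharacter L) (s : ℂ) (v : HeightOneSpectrum (𝓞 (Fp L)))
    (y : AdeleRing (𝓞 L) L) (hy : conjAdele (Fp L) L (IsCMField.complexConj L) y = -y) (t : AdeleRing (𝓞 L) L)
    (g₂ : (quasiSplit (Fp L) L (IsCMField.complexConj L) 2).Adelic) :
    LambdaLoc L e dV hdV dW hdW v χ s
        (UnitaryGroup.evalPlace (Fp L) L (IsCMField.complexConj L) (2 + 2) (hermD L e dV hdV dW hdW) v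
          (UnitaryGroup.finPart (Fp L) L (IsCMField.complexConj L) (2 + 2) (hermD L e dV hdV dW hdW)
            (Ψ (jAdelic L 4 (weylXi (AdeleRing (𝓞 L) L) (conjAdele (Fp L) L (IsCMField.complexConj L)))) *
              Ψ (jAdelic L 4 (nKlingen (AdeleRing (𝓞 L) L) (conjAdele (Fp L) L (IsCMField.complexConj L)) (conjAdele_conjAdele' L) y hy 0 t)) *
              (Ψ (jAdelic L 4 (klingenLevi (AdeleRing (𝓞 L) L) (conjAdele (Fp L) L (IsCMField.complexConj L)) (conjAdele_conjAdele' L) 1 ((jAdelic L 2).symm g₂))) * h)))) =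
      LambdaLoc L e dV hdV dW hdW v χ s
        (psiLoc L Ψ v (weylXiLoc L v * nKlingenLoc L v (adeleToLocal L v y) (adeleToLocal_mem_skewLoc L v hy) 0 (adeleToLocal L v t) *
            klingenLeviLoc L v 1 (UnitaryGroup.evalPlace (Fp L) L (IsCMField.complexConj L) 2 ((StdForm.antidiagonal 2).over L) v
              (UnitaryGroup.finPart (Fp L) L (IsCMField.complexConj L) 2 ((StdForm.antidiagonal 2).over L) g₂))) *
          UnitaryGroup.evalPlace (Fp L) L (IsCMField.complexConj L) (2 + 2) (hermD L e dV hdV dW hdW) v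
            (UnitaryGroup.finPart (Fp L) L (IsCMField.complexConj L) (2 + 2) (hermD L e dV hdV dW hdW) h)) := by
  rw [← evalPlace_finPart_letters_zero L Ψ SA hΨ v y hy t g₂ h]
  rfl
set_option simprocs false in -- as above
set_option maxHeartbeats 400000 in
include hΨ in
/-- **THE SHAPE `hF` OF ★ E-D0 FOR THE TERM-2 INTEGRAND**: for `f` ★ #31s-factorizable off `T′` (`hfac`) and `gN` as in `exists_tensor` (i),
`f_s(Ψ(ξ)·Ψ(n_Q(y,0,t))·(Ψ(m_Q(1,j₂⁻¹g₂))·h)) = gN s g₂ (π q) · ∏ᶠ_{v∉T′} φ_v(y_v, t_v)` with `φ_v(p) = Λ_{s,v}(Ψ_v(ξ_v · n_{Q,v}(p.1, 0, p.2) · m_{Q,v}(1, (g₂)_v)) · h_v)` — the integrand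
of ★ B `innerSectionLoc v … (psiLoc Ψ v) (Λ_{s,v}) h_v (g₂)_v` (★ E-1 `integrand_eq_mul_finprod`). [cite: Liu2011, §2B p. 862] [cite: MoeglinWaldspurger1995, II.1.7] -/
theorem integrand_eq_tensor_mul_finprod (χ : HeckeCharacter L) (f : ℂ → HA L e dV hdV dW hdW → ℂ) (hfac : IsFactorizableOff L e dV hdV dW hdW T' χ f fT)
    (gN : ℂ → (quasiSplit (Fp L) L (IsCMField.complexConj L) 2).Adelic →
      (InfiniteAdeleRing L × InfiniteAdeleRing L) × (Π v : T', Fin 3 → v.1.adicCompletion (Fp L)) → ℂ)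
    (s : ℂ) (g₂ : (quasiSplit (Fp L) L (IsCMField.complexConj L) 2).Adelic)
    (hgN : haveI : Algebra.IsQuadraticExtension (Fp L) L := IsCMField.isQuadraticExtension L
      ∀ q : ↥Y × AdeleRing (𝓞 L) L,
        fT s (UnitaryGroup.archPart (Fp L) L (IsCMField.complexConj L) (2 + 2) (hermD L e dV hdV dW hdW)
                (Ψ (jAdelic L 4 (weylXi (AdeleRing (𝓞 L) L) (conjAdele (Fp L) L (IsCMField.complexConj L)))) *
                  Ψ (jAdelic L 4 (nKlingen (AdeleRing (𝓞 L) L) (conjAdele (Fp L) L (IsCMField.complexConj L)) (conjAdele_conjAdele' L)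
                    (((q.1 : ↥Y) : AdeleRing (𝓞 L) L)) ((hY _).1 q.1.2) 0 q.2)) *
                  (Ψ (jAdelic L 4 (klingenLevi (AdeleRing (𝓞 L) L) (conjAdele (Fp L) L (IsCMField.complexConj L)) (conjAdele_conjAdele' L) 1 ((jAdelic L 2).symm g₂))) * h)),
              fun v : T' => UnitaryGroup.evalPlace (Fp L) L (IsCMField.complexConj L) (2 + 2) (hermD L e dV hdV dW hdW) v.1
                (UnitaryGroup.finPart (Fp L) L (IsCMField.complexConj L) (2 + 2) (hermD L e dV hdV dW hdW)
                  (Ψ (jAdelic L 4 (weylXi (AdeleRing (𝓞 L) L) (conjAdele (Fp L) L (IsCMField.complexConj L)))) *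
                    Ψ (jAdelic L 4 (nKlingen (AdeleRing (𝓞 L) L) (conjAdele (Fp L) L (IsCMField.complexConj L)) (conjAdele_conjAdele' L)
                      (((q.1 : ↥Y) : AdeleRing (𝓞 L) L)) ((hY _).1 q.1.2) 0 q.2)) *
                    (Ψ (jAdelic L 4 (klingenLevi (AdeleRing (𝓞 L) L) (conjAdele (Fp L) L (IsCMField.complexConj L)) (conjAdele_conjAdele' L) 1 ((jAdelic L 2).symm g₂))) * h)))) =
          gN s g₂ ((((q.1 : AdeleRing (𝓞 L) L)).1, q.2.1),
            fun v : T' => ![((quadraticAdeleEquiv (Fp L) L (IsCMField.complexConj L) hσδ hδ).symm (q.1 : AdeleRing (𝓞 L) L)).2.2 v.1,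
              ((quadraticAdeleEquiv (Fp L) L (IsCMField.complexConj L) hσδ hδ).symm q.2).1.2 v.1,
              ((quadraticAdeleEquiv (Fp L) L (IsCMField.complexConj L) hσδ hδ).symm q.2).2.2 v.1]))
    (q : ↥Y × AdeleRing (𝓞 L) L) :
    haveI : Algebra.IsQuadraticExtension (Fp L) L := IsCMField.isQuadraticExtension L
    f s (Ψ (jAdelic L 4 (weylXi (AdeleRing (𝓞 L) L) (conjAdele (Fp L) L (IsCMField.complexConj L)))) *
          Ψ (jAdelic L 4 (nKlingen (AdeleRing (𝓞 L) L) (conjAdele (Fp L) L (IsCMField.complexConj L)) (conjAdele_conjAdele' L)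
            (((q.1 : ↥Y) : AdeleRing (𝓞 L) L)) ((hY _).1 q.1.2) 0 q.2)) *
          (Ψ (jAdelic L 4 (klingenLevi (AdeleRing (𝓞 L) L) (conjAdele (Fp L) L (IsCMField.complexConj L)) (conjAdele_conjAdele' L) 1 ((jAdelic L 2).symm g₂))) * h)) =
      gN s g₂ ((((q.1 : AdeleRing (𝓞 L) L)).1, q.2.1),
          fun v : T' => ![((quadraticAdeleEquiv (Fp L) L (IsCMField.complexConj L) hσδ hδ).symm (q.1 : AdeleRing (𝓞 L) L)).2.2 v.1,
            ((quadraticAdeleEquiv (Fp L) L (IsCMField.complexConj L) hσδ hδ).symm q.2).1.2 v.1,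
            ((quadraticAdeleEquiv (Fp L) L (IsCMField.complexConj L) hσδ hδ).symm q.2).2.2 v.1]) *
        ∏ᶠ v : {v : HeightOneSpectrum (𝓞 (Fp L)) // v ∉ T'},
          (fun p : ↥(skewLoc L v.1) × LocalRing L v.1 =>
            LambdaLoc L e dV hdV dW hdW v.1 χ s
              (psiLoc L Ψ v.1
                  (weylXiLoc L v.1 * nKlingenLoc L v.1 (p.1 : LocalRing L v.1) p.1.2 0 p.2 *
                    klingenLeviLoc L v.1 1 (UnitaryGroup.evalPlace (Fp L) L (IsCMField.complexConj L) 2 ((StdForm.antidiagonal 2).over L) v.1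
                      (UnitaryGroup.finPart (Fp L) L (IsCMField.complexConj L) 2 ((StdForm.antidiagonal 2).over L) g₂))) *
                UnitaryGroup.evalPlace (Fp L) L (IsCMField.complexConj L) (2 + 2) (hermD L e dV hdV dW hdW) v.1
                  (UnitaryGroup.finPart (Fp L) L (IsCMField.complexConj L) (2 + 2) (hermD L e dV hdV dW hdW) h)))
            (⟨adeleToLocal L v.1 (q.1 : AdeleRing (𝓞 L) L), adeleToLocal_mem_skewLoc L v.1 ((hY _).1 q.1.2)⟩, adeleToLocal L v.1 q.2) := by
  haveI : Algebra.IsQuadraticExtension (Fp L) L := IsCMField.isQuadraticExtension L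
  rw [hfac s, hgN q]
  congr 1
  refine finprod_congr fun v => ?_
  dsimp only
  exact local_factor_eq L Ψ SA hΨ h χ s v.1 _ ((hY _).1 q.1.2) q.2 g₂

end Tensor

end Summit.HodgeConjecture.HodgeConjecture.Cruxes.HLiu418.K2LiuKlingenTermTwoTensor

end
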